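import Mathlib
import Literature.Analysis.FluidPDE.CheskidovShvydkoyRegularProofs
import Literature.Analysis.FluidPDE.NSEnstrophyPersistence
import Literature.Analysis.FluidPDE.NSUnconditionalUniquenessHolds
import Literature.Analysis.FluidPDE.TaoLocalisationHolds
import Literature.Analysis.FluidPDE.TaoLocalisationProofs
import Literature.Analysis.FluidPDE.ClassicalSolutionGlue
import Summits.NavierStokesRegularity.NavierStokesRegularity.Theorems.PlaneEnergyCeilingPlanarEnergyAPrioriCriticalCorners
import Summits.NavierStokesRegularity.NavierStokesRegularity.Theorems.Target.Negative.CounterexampleProfile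

/-!
# Route PlaneEnergyCeiling · crux `PlanarEnergyAPriori` — the Ladyzhenskaya–Prodi–Serrin corner

Helper file for the crux item stmt-NavierStokesRegularity-16855 (`PlanarEnergyAPriori`, route
`PlaneEnergyCeiling`), landed `--supports` that item: THE CRUX HOLDS IN EVERY
LADYZHENSKAYA–PRODI–SERRIN CLASS. Along every classical solution of unforced Navier–Stokes on
`ℝ³ × [0,T)` that is Leray–Hopf from a rapidly decaying datum and lies in `L^q(0,T;L^r(ℝ³))` with
`3 < r`, `2/q + 3/r ≤ 1`, the planar kinetic energies are bounded uniformly in `t < T`, the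
direction and the offset (`planarCeiling_of_memLqLp`).

Proof (`velocity_bounded_of_memLqLp`): the discharged LPS theorem `ladyzhenskaya_prodi_serrin_holds`
(RRS 2016 Thm. 8.17) gives a classical representative `v` on `(0,T]` (closed at `T`) with
`u(t) = v(t)` a.e., hence everywhere on `(0,T)` (both continuous). On the late closed slab
`[T/2,T]` (translated to `[0,T/2]`, `IsClassicalNSSolutionOn.comp_add_right`) `v` has all
Sobolev norms bounded — datum `v(T/2) = u(T/2)` has all derivatives in `L²` by the closed-slab
bounds of `u` on `[0,T/2]` (discharged `tao2011_hasBoundedSobolevNormsOn_holds`), then discharged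
`tao2011_boundedEnstrophy_holds` + `tao2011_hasBoundedSobolevNormsOn_of_memSobolevX_holds` — so `v`,
hence `u`, is bounded on `[T/2,T)` (discharged imbedding `linfty_bound_of_hasBoundedSobolevNormsOn_holds`);
on `[0,T/2]` `u` is bounded by the landed `Target.Negative.pointwise_bounded_before`. The landed
`planarCeiling_of_velocity_bounded` (`…CriticalCorners.lean`) concludes. Folklore assembly of
accepted facts.
-/

noncomputable section

-- single-conjunct summit: `Summit.<Summit>.<Problem>` repeats the name by the D-0017 layout
set_option linter.dupNamespace false

namespace Summit.NavierStokesRegularity.NavierStokesRegularity.Theorems.PlanarEnergyAPriori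

open MeasureTheory Set Filter Topology Function WithLp
open scoped ENNReal NNReal
open Literature.Analysis.FluidPDE

variable {ν T : ℝ} {u : ℝ → EuclideanSpace ℝ (Fin 3) → EuclideanSpace ℝ (Fin 3)} {p : ℝ → EuclideanSpace ℝ (Fin 3) → ℝ}

/-- **A classical Leray–Hopf solution in a Ladyzhenskaya–Prodi–Serrin class is bounded on
`[0,T) × ℝ³`.** (`ν, T > 0`, rapidly decaying datum, `u ∈ L^q(0,T;L^r)`, `3 < r`,
`2/q + 3/r ≤ 1`.) [folklore] -/
theorem velocity_bounded_of_memLqLp (hν : 0 < ν) (hT : 0 < T)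
    (hcl : IsClassicalNSSolutionOn (Ico 0 T) ν 0 u p) (hLH : IsLerayHopfOn T ν 0 (u 0) u)
    (hdec : HasRapidSpatialDecay (u 0)) {q r : ℝ≥0∞} (hr : 3 < r) (hqr : 2 / q + 3 / r ≤ 1)
    (hS : MemLqLp q r u (Ioo 0 T)) :
    ∃ M : ℝ, ∀ t ∈ Ico 0 T, ∀ x, ‖u t x‖ ≤ M := by
  -- the classical representative up to and including `T`
  obtain ⟨v, pv, hv, hae⟩ := ladyzhenskaya_prodi_serrin_holds hν hT hLH hr hqr hS
  have heq : ∀ t ∈ Ioo 0 T, u t = v t := fun t ht =>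
    ((hcl.contDiff_velocity ⟨ht.1.le, ht.2⟩).continuous.ae_eq_iff_eq volume
      (hv.contDiff_velocity ⟨ht.1, ht.2.le⟩).continuous).1 (hae t ⟨ht.1, ht.2.le⟩)
  -- the late closed slab `[ε, T]`, `ε = T/2`, translated to `[0, T - ε]`
  set ε : ℝ := T / 2 with hεdef
  have hε : 0 < ε := by rw [hεdef]; linarith
  have hεT : ε < T := by rw [hεdef]; linarith
  have hTε : 0 < T - ε := by linarith
  have hv' : IsClassicalNSSolutionOn (Icc 0 (T - ε)) ν 0 (fun s => v (s + ε)) (fun s => pv (s + ε)) := by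
    have h := (hv.comp_add_right ε).mono (S' := Icc 0 (T - ε))
      (fun s hs => ⟨by simp only [mem_Icc] at hs; linarith [hs.1], by simp only [mem_Icc] at hs; linarith [hs.2]⟩)
      (uniqueDiffOn_Icc hTε)
    exact h.congr_force fun s _ x => by simp
  -- energy of the translate from the Leray–Hopf inequality of `u`
  have hE' : ∃ C : ℝ≥0, ∀ s ∈ Icc 0 (T - ε), ∫⁻ x, ‖v (s + ε) x‖ₑ ^ 2 ≤ C := by
    refine ⟨(2 * VectorCalculus.kineticEnergy (u 0)).toNNReal, fun s hs => ?_⟩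
    have hmem : s + ε ∈ Ioc 0 T := ⟨by linarith [hs.1], by linarith [hs.2]⟩
    have hcongr : ∫⁻ x, ‖v (s + ε) x‖ₑ ^ 2 = ∫⁻ x, ‖u (s + ε) x‖ₑ ^ 2 :=
      lintegral_congr_ae ((hae _ hmem).mono fun x hx => by simp only [hx])
    rw [hcongr]
    exact hLH.lintegral_enorm_sq_le hν.le ⟨hmem.1.le, hmem.2⟩
  -- all Sobolev norms of the datum `v ε = u ε` are finite (closed sub-slab `[0, ε]` of `u`)
  have hclε : IsClassicalNSSolutionOn (Icc 0 ε) ν 0 u p :=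
    hcl.mono (Icc_subset_Ico_right hεT) (uniqueDiffOn_Icc hε)
  have hEε : ∃ C : ℝ≥0, ∀ t ∈ Icc 0 ε, ∫⁻ x, ‖u t x‖ₑ ^ 2 ≤ C :=
    ⟨(2 * VectorCalculus.kineticEnergy (u 0)).toNNReal, fun t ht =>
      hLH.lintegral_enorm_sq_le hν.le ⟨ht.1, ht.2.trans hεT.le⟩⟩
  have hHu : HasBoundedSobolevNormsOn (Icc 0 ε) u := tao2011_hasBoundedSobolevNormsOn_holds hν hε hclε hEε hdec
  have hHk : ∀ n : ℕ, ∫⁻ x, ‖iteratedFDeriv ℝ n ((fun s => v (s + ε)) 0) x‖ₑ ^ 2 < ⊤ := fun n => by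
    obtain ⟨C, hC⟩ := hHu n
    have h0 : (fun s => v (s + ε)) 0 = u ε := by
      show v (0 + ε) = u ε
      rw [zero_add, heq ε ⟨hε, hεT⟩]
    rw [h0]
    exact (hC ε ⟨hε.le, le_rfl⟩).trans_lt ENNReal.coe_lt_top
  have hX := tao2011_boundedEnstrophy_holds hν hTε hv' hE' (hHk 1)
  have hHv : HasBoundedSobolevNormsOn (Icc 0 (T - ε)) (fun s => v (s + ε)) :=
    tao2011_hasBoundedSobolevNormsOn_of_memSobolevX_holds hν hTε hv' hX hHk
  obtain ⟨M₂, hM₂⟩ := linfty_bound_of_hasBoundedSobolevNormsOn_holds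
    (fun s hs => (hv'.contDiff_velocity hs).of_le (by norm_cast)) hHv
  -- the early closed slab `[0, ε]`
  obtain ⟨M₁, hM₁⟩ :=
    Summit.NavierStokesRegularity.NavierStokesRegularity.Theorems.Target.Negative.pointwise_bounded_before
      hν hcl hLH hdec ε hεT
  refine ⟨max M₁ M₂, fun t ht x => ?_⟩
  rcases le_or_gt t ε with h | h
  · exact (hM₁ t ⟨ht.1, h⟩ x).trans (le_max_left _ _)
  · have hb : ‖v (t - ε + ε) x‖ ≤ M₂ := hM₂ (t - ε) ⟨by linarith, by linarith [ht.2]⟩ x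
    rw [sub_add_cancel, ← heq t ⟨hε.trans h, ht.2⟩] at hb
    exact hb.trans (le_max_right _ _)

/-- **THE CRUX IN EVERY LADYZHENSKAYA–PRODI–SERRIN CLASS.** Along every classical solution of
unforced Navier–Stokes on `ℝ³ × [0,T)` (`ν, T > 0`) that is Leray–Hopf from a rapidly decaying
datum and lies in `L^q(0,T;L^r(ℝ³))`, `3 < r`, `2/q + 3/r ≤ 1`, the planar kinetic energies
`∫_{R{x₂=c}} |u(t)|² dA` are bounded uniformly in `t < T`, `R`, `c`. [folklore] -/
theorem planarCeiling_of_memLqLp (hν : 0 < ν) (hT : 0 < T)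
    (hcl : IsClassicalNSSolutionOn (Ico 0 T) ν 0 u p) (hLH : IsLerayHopfOn T ν 0 (u 0) u)
    (hdec : HasRapidSpatialDecay (u 0)) {q r : ℝ≥0∞} (hr : 3 < r) (hqr : 2 / q + 3 / r ≤ 1)
    (hS : MemLqLp q r u (Ioo 0 T)) :
    ∃ M : ℝ, ∀ t ∈ Ico 0 T, ∀ (R : EuclideanSpace ℝ (Fin 3) ≃ₗᵢ[ℝ] EuclideanSpace ℝ (Fin 3)) (c : ℝ),
      ∫⁻ y : EuclideanSpace ℝ (Fin 2), ‖u t (R (toLp 2 ![y 0, y 1, c]))‖ₑ ^ 2 ≤ ENNReal.ofReal M :=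
  planarCeiling_of_velocity_bounded hν hT hcl hLH hdec (velocity_bounded_of_memLqLp hν hT hcl hLH hdec hr hqr hS)

/-- **The crux in every Ladyzhenskaya–Prodi–Serrin class, registered closed form** (sub-goal
`planarCeiling_of_memLqLp_closedForm` of stmt-NavierStokesRegularity-16855). [folklore] -/
theorem planarCeiling_of_memLqLp_closedForm : ∀ (ν T : ℝ), 0 < ν → 0 < T → ∀ (u : ℝ → EuclideanSpace ℝ (Fin 3) → EuclideanSpace ℝ (Fin 3)) (p : ℝ → EuclideanSpace ℝ (Fin 3) → ℝ), Literature.Analysis.FluidPDE.IsClassicalNSSolutionOn (Set.Ico 0 T) ν 0 u p → Literature.Analysis.FluidPDE.IsLerayHopfOn T ν 0 (u 0) u → Literature.Analysis.FluidPDE.HasRapidSpatialDecay (u 0) → ∀ (q r : ENNReal), 3 < r → 2 / q + 3 / r ≤ 1 → Literature.Analysis.FluidPDE.MemLqLp q r u (Set.Ioo 0 T) → ∃ M : ℝ, ∀ t ∈ Set.Ico 0 T, ∀ (R : EuclideanSpace ℝ (Fin 3) ≃ₗᵢ[ℝ] EuclideanSpace ℝ (Fin 3)) (c : ℝ), ∫⁻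 y : EuclideanSpace ℝ (Fin 2), ‖u t (R (WithLp.toLp 2 ![y 0, y 1, c]))‖ₑ ^ 2 ≤ ENNReal.ofReal M :=
  fun _ _ hν hT _ _ hcl hLH hdec _ _ hr hqr hS => planarCeiling_of_memLqLp hν hT hcl hLH hdec hr hqr hS

end Summit.NavierStokesRegularity.NavierStokesRegularity.Theorems.PlanarEnergyAPriori

end
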